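import Literature.NumberTheory.EllipticCurves.DeligneSerreProp27LevelDescentProofs
import Literature.NumberTheory.EllipticCurves.DeligneSerreProp27Proofs
import HarnessLib

/-!
# Deligne–Serre 1974, Prop. 2.7 (2.7.4) — the discharge `prop27_conj_holds`

A proofs-only leaf (one theorem; no definition, no named fact; D-0026) discharging the named fact
`Literature.NumberTheory.EllipticCurves.ModularForms.DeligneSerre1974.prop27_conj`
(`Literature.NumberTheory.EllipticCurves.DeligneSerreRankinProofs`; Deligne–Serre, *Formes
modulaires de poids 1*, Ann. Sci. ÉNS (4) 7 (1974), Prop. 2.7 (2.7.4), p. 512): *"Si `f ∈ S_ℂ` est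
telle que `f ∣ T_p = a_p f`, alors, pour tout automorphisme `σ` de `ℂ`, la forme `σ(f)` est telle
que `σ(f) ∣ T_p = σ(a_p) σ(f)`.  Si `f` est de type `(k, ε)` sur `Γ₀(N)`, alors `σ(f)` est de type
`(k, σ(ε))"* — in the embedding form of the named fact: for a non-zero cusp form `f` of type
`(k, ε)` on `Γ₀(N)`, eigen for the `T_p`, `p ∤ N`, a subfield `K ⊆ ℂ` containing the eigenvalues
`a_p` and an embedding `τ : K → ℂ`, there are a character `ε'` and a non-zero cusp form `g` of type
`(k, ε')` on `Γ₀(N)` with `T_p g = τ(a_p) g` for all `p ∤ N`.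

The printed proof (p. 512) reads (2.7.3) and (2.7.4) off (2.7.2) — *"`L ⊗ K → S_K` est un
isomorphisme"*: in a `ℤ`-basis of the lattice `L` of cusp forms all of whose diamond twists have
integral Fourier coefficients the `T_p` and `⟨d⟩` have integer matrices, so an eigenvector can be
transported along any automorphism of `ℂ`.  In the tree:

* **(2.7.4) from (2.7.2)** is `DeligneSerre1974.prop27_conj_of_span_integralLattice1`
  (`DeligneSerreProp27Proofs`: the number field generated by the eigenvalues of `f` under
  `{T_p}_{p ∤ N} ∪ {⟨d⟩}`, extension of `τ` to it, transport of the eigenvector in the integral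
  basis, `LatticeEigen.exists_eigenvector_conj`);
* **(2.7.2)** at every level `N ≥ 1` and every weight `k` is
  `DeligneSerre1974_span_integralLattice1_holds` (`DeligneSerreProp27LevelDescentProofs`): for
  `N ≥ 5` the rank half of Eichler–Shimura for `Γ₁(N)` by weight-`k` Manin symbols
  (`ManinSymbolsWeightKGamma1Rank*`; Shimura 1971 Thm. 8.4, Merel 1994 §1.2–1.4) against the
  dimension lower bound for `S_k(Γ₁(N))` by the free-module route (`ModularFormsGamma1Dimension`,
  `ModularFormsGamma1OddDimension`), Shimura's Hecke-stable real lattice (3.5.20) and Thm. 3.52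
  (`DeligneSerreSpanHeckeDualityProofs`, `DeligneSerreProp27RealLatticeProofs`), and the weight
  descents (`DeligneSerreProp27WeightReductionProofs`, `DeligneSerreProp27WeightOneDescentProofs`);
  for `N ≤ 4` by descent of the level from `5N` through the degeneracy map `[α₅]_k`.

Everything here is proved; no named facts are introduced.

## References

* P. Deligne, J.-P. Serre, *Formes modulaires de poids 1*, Ann. Sci. ÉNS (4) 7 (1974), 507–530,
  Prop. 2.7 (2.7.2)–(2.7.4), Rem. 2.8 (p. 512). doi:10.24033/asens.1277 [DeligneSerreASENS1974]
* G. Shimura, *Introduction to the arithmetic theory of automorphic functions*, Publ. Math. Soc.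
  Japan 11 (1971): (3.5.20), Thm. 3.48, Thm. 3.52, Thm. 8.4.
-/

noncomputable section

namespace Literature.NumberTheory.EllipticCurves.ModularForms.DeligneSerre1974

/-- **Deligne–Serre 1974, Prop. 2.7 (2.7.4)** (the named fact `prop27_conj`, discharged): for a
non-zero cusp form `f` of type `(k, ε)` on `Γ₀(N)` which is an eigenfunction of the `T_p`, `p ∤ N`,
with eigenvalues `a_p`, a subfield `K ⊆ ℂ` containing the `a_p` and an embedding `τ : K → ℂ`, there
are a character `ε'` modulo `N` and a non-zero cusp form `g` of type `(k, ε')` on `Γ₀(N)` with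
`T_p g = τ(a_p) g` for every prime `p ∤ N` (*"`σ(f) ∣ T_p = σ(a_p) σ(f)` … `σ(f)` est de type
`(k, σ(ε))`"*).  Proof: `prop27_conj_of_span_integralLattice1` ((2.7.4) from (2.7.2), as printed)
fed with (2.7.2) at every level and weight, `DeligneSerre1974_span_integralLattice1_holds`.
[cite: DeligneSerreASENS1974, Prop. 2.7 (2.7.4), p. 512] -/
theorem prop27_conj_holds : prop27_conj :=
  prop27_conj_of_span_integralLattice1 fun N _ k ↦ DeligneSerre1974_span_integralLattice1_holds N k

end Literature.NumberTheory.EllipticCurves.ModularForms.DeligneSerre1974
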